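import Mathlib

/-!
# Preprocessed read-once formulas and polynomials (Shpilka–Volkovich; Minahan–Volkovich)

A **read-once formula** (ROF) is an arithmetic formula in which every variable labels at most one
leaf; a **preprocessed read-once formula** (PROF) allows each leaf to apply an arbitrary univariate
polynomial `T_μ` to its variable `x_μ` first, and its internal `+` / `×` nodes combine subformulas on
DISJOINT sets of variables (Minahan–Volkovich 2017, Def. 9 and Def. 12; Shpilka–Volkovich 2015). The
polynomials so computed are the (preprocessed) read-once polynomials, ROPs ⊆ PROPs; they are the
objects of the Shpilka–Volkovich / Minahan–Volkovich identity tests (the generator `G_{n,t}`).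

We record the notion as an inductive PREDICATE `IsPROP S P` on `MvPolynomial ι R`: "`P` is computed
by a preprocessed read-once formula whose leaves are labelled by the variables of the finite set `S`,
each variable of `S` labelling exactly one leaf" — constants (no leaf), a leaf `T(x_μ)` (`S = {μ}`),
and sums / products of two such formulas on disjoint leaf sets. The affine node labels
`(α, β) : Φ ↦ α Φ + β` of Minahan–Volkovich's Def. 12 are the derived rule `IsPROP.affine`
(multiply by the constant formula `α`, add the constant formula `β`); ordinary read-once formulas are
the case of leaves `T` of degree `≤ 1` (`IsPROP.X`). Design choice: the leaf set `S` is EXACT (the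
union of the leaf variables), which makes `P.vars ⊆ S` (`IsPROP.vars_subset`) and the cardinality
bookkeeping of the Shpilka–Volkovich induction ("one of the two subformulas carries at most half of
the variables") immediate; enlarging `S` is nevertheless derivable (`IsPROP.mono`, padding with zero
leaves). Deliberately NOT here: the generator `G_{n,t}` and the hitting theorems (Shpilka–Volkovich
2015 Thm. 1; Minahan–Volkovich 2017 Thm. 20), sums of `k` read-once formulas, read-`k` formulas.

References:
* [MinahanVolkovich2017] D. Minahan, I. Volkovich, CCC 2017 (LIPIcs 79) 32, Def. 9, Def. 12, Lemma 13.
* [ShpilkaVolkovich2015] A. Shpilka, I. Volkovich, Comput. Complexity 24 (2015) 477–532, §3 (ROFs, PROPs).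
-/

namespace Literature.Computability.AlgebraicComplexity

open MvPolynomial

variable {R : Type*} [CommSemiring R] {ι : Type*} [DecidableEq ι]

/-- **Preprocessed read-once polynomials (PROPs).** `IsPROP S P`: the polynomial `P` is computed by a
preprocessed read-once formula whose leaf variables are exactly the finite set `S`, each used once:
a constant (no leaves); a leaf `T(x_μ)` for a univariate `T` (`S = {μ}`); the sum or the product of two
such formulas on DISJOINT leaf sets `S₁`, `S₂` (`S = S₁ ∪ S₂`). Read-once formulas/polynomials
(ROF/ROP) are the special case of affine leaves `T = a x + b`.
[cite: MinahanVolkovich2017, Def. 9 and Def. 12] -/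
inductive IsPROP : Finset ι → MvPolynomial ι R → Prop
  /-- a constant formula (no leaf). [cite: MinahanVolkovich2017, Def. 12] -/
  | const (a : R) : IsPROP ∅ (C a)
  /-- a preprocessed leaf `T(x_μ)`. [cite: MinahanVolkovich2017, Def. 11 and Def. 12] -/
  | leaf (μ : ι) (T : Polynomial R) : IsPROP {μ} (Polynomial.aeval (X μ : MvPolynomial ι R) T)
  /-- a sum node on disjoint leaf sets. [cite: MinahanVolkovich2017, Def. 12] -/
  | add {S₁ S₂ : Finset ι} {P Q : MvPolynomial ι R} :
      IsPROP S₁ P → IsPROP S₂ Q → Disjoint S₁ S₂ → IsPROP (S₁ ∪ S₂) (P + Q)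
  /-- a product node on disjoint leaf sets. [cite: MinahanVolkovich2017, Def. 12] -/
  | mul {S₁ S₂ : Finset ι} {P Q : MvPolynomial ι R} :
      IsPROP S₁ P → IsPROP S₂ Q → Disjoint S₁ S₂ → IsPROP (S₁ ∪ S₂) (P * Q)

namespace IsPROP

/-- A single variable `x_μ` is a read-once formula (leaf `T = x`). [cite: MinahanVolkovich2017, Def. 9] -/
theorem X (μ : ι) : IsPROP ({μ} : Finset ι) (MvPolynomial.X μ : MvPolynomial ι R) := by
  simpa using IsPROP.leaf (R := R) μ Polynomial.X

/-- The affine node/leaf labels `(α, β)` of Minahan–Volkovich's Def. 12: `α • Φ + β` is computed on the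
same leaf set (multiply by the constant formula `α`, add the constant formula `β`).
[cite: MinahanVolkovich2017, Def. 12] -/
theorem affine {S : Finset ι} {P : MvPolynomial ι R} (h : IsPROP S P) (a b : R) :
    IsPROP S (C a * P + C b) := by
  have h1 : IsPROP (∅ ∪ S) (C a * P) := IsPROP.mul (IsPROP.const a) h (Finset.disjoint_empty_left S)
  rw [Finset.empty_union] at h1
  have h2 : IsPROP (S ∪ ∅) (C a * P + C b) := IsPROP.add h1 (IsPROP.const b) (Finset.disjoint_empty_right S)
  rwa [Finset.union_empty] at h2

/-- The variables of a (preprocessed) read-once polynomial lie in its leaf set. [folklore] -/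
theorem vars_subset {S : Finset ι} {P : MvPolynomial ι R} (h : IsPROP S P) : P.vars ⊆ S := by
  induction h with
  | const a => simp
  | leaf μ T =>
      have hX : (MvPolynomial.X μ : MvPolynomial ι R).vars ⊆ {μ} := by
        rcases subsingleton_or_nontrivial R with hR | hR
        · rw [Subsingleton.elim (MvPolynomial.X μ : MvPolynomial ι R) 0, MvPolynomial.vars_0]
          exact Finset.empty_subset _
        · rw [MvPolynomial.vars_X]
      rw [Polynomial.aeval_eq_sum_range]
      refine (MvPolynomial.vars_sum_subset _ _).trans (Finset.biUnion_subset.mpr fun i _ => ?_)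
      rw [MvPolynomial.smul_eq_C_mul]
      refine (MvPolynomial.vars_mul _ _).trans (Finset.union_subset ?_ ?_)
      · rw [MvPolynomial.vars_C]
        exact Finset.empty_subset _
      · exact (MvPolynomial.vars_pow _ _).trans hX
  | add _ _ _ ih₁ ih₂ =>
      exact (MvPolynomial.vars_add_subset _ _).trans (Finset.union_subset_union ih₁ ih₂)
  | mul _ _ _ ih₁ ih₂ =>
      exact (MvPolynomial.vars_mul _ _).trans (Finset.union_subset_union ih₁ ih₂)

/-- The zero polynomial is computed on any prescribed leaf set (a sum of zero leaves `0(x_μ)`,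
`μ ∈ S`). [folklore] -/
theorem zero (S : Finset ι) : IsPROP S (0 : MvPolynomial ι R) := by
  induction S using Finset.induction_on with
  | empty => simpa using IsPROP.const (R := R) (ι := ι) 0
  | insert μ S hμ ih =>
      have hleaf : IsPROP ({μ} : Finset ι) (0 : MvPolynomial ι R) := by
        simpa using IsPROP.leaf (R := R) μ (0 : Polynomial R)
      have h := IsPROP.add hleaf ih (Finset.disjoint_singleton_left.mpr hμ)
      rwa [add_zero, Finset.insert_eq] at *

/-- Enlarging the leaf set: a formula on the leaves `S` is also one on any `S' ⊇ S` (pad with zero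
leaves on `S' \ S`). [folklore] -/
theorem mono {S S' : Finset ι} {P : MvPolynomial ι R} (h : IsPROP S P) (hSS' : S ⊆ S') :
    IsPROP S' P := by
  have h' := IsPROP.add h (IsPROP.zero (S' \ S)) Finset.disjoint_sdiff
  rwa [add_zero, Finset.union_sdiff_of_subset hSS'] at h'

/-- Constants are computed on any leaf set. [folklore] -/
theorem C_mem (S : Finset ι) (a : R) : IsPROP S (C a : MvPolynomial ι R) :=
  (IsPROP.const a).mono (Finset.empty_subset S)

end IsPROP

/-- Sanity check of the intended reading: `(x₀ + 1) · x₁² + 3` is a preprocessed read-once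
polynomial on the leaves `{0, 1}`. [folklore] -/
example : IsPROP ({0} ∪ {1} : Finset (Fin 2))
    ((MvPolynomial.X 0 + C 1) * (MvPolynomial.X 1 ^ 2) + C 3 : MvPolynomial (Fin 2) ℚ) := by
  have h0 : IsPROP ({0} : Finset (Fin 2)) (MvPolynomial.X 0 + C 1 : MvPolynomial (Fin 2) ℚ) := by
    simpa using (IsPROP.X (R := ℚ) (0 : Fin 2)).affine 1 1
  have h1 : IsPROP ({1} : Finset (Fin 2)) (MvPolynomial.X 1 ^ 2 : MvPolynomial (Fin 2) ℚ) := by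
    have h := IsPROP.leaf (R := ℚ) (1 : Fin 2) (Polynomial.X ^ 2)
    rwa [map_pow, Polynomial.aeval_X] at h
  simpa using (IsPROP.mul h0 h1 (by decide)).affine 1 3

end Literature.Computability.AlgebraicComplexity
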